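import Summits.ResolutionOfSingularities.ResolutionOfSingularities.Theorems.WeightedInvariantIota3CriticalReduction
import HarnessLib

/-!
# NON-SOLVABILITY IN THE CRITICAL GRADED RING: the pure part `π` of `f` satisfies `π − u·(g₁ − t g₂^ρ)^ν ∉ F₃(j r₁ ν + 1)` for all
# `u, t` (door `HypersurfaceCentreConstruction`, stmt-ResolutionOfSingularities-19897; brick 6 of hres₃ of `keyRungGrHomLE_three_of_residue3`)

Helper for `stub_keyRungGrHomLE_three` (def-free, `--supports 19897`).  Sequel of …Iota3CriticalReduction.  The bridge between LEMMA B
(…Iota3RatioMaxNonSolvable, stated at the original triple `(q; r₁, r₂)`) and the critical graded ring `gr_{F₃} S = κ[X, V, Y]`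
(`F₃ = F_{(g₁,g₂; r₂, j r₁, j r₂)}`), by WEIGHTED QUASI-REGULARITY (Literature `coeff_mem_maximalIdeal_of_weval_mem_general`):

* `pureIdeal_eq_span` — the pure ideal `P = ⨆_{r₁α + r₂β = r₁ν} (g₁^α g₂^β)` as a span; `exists_poly_of_mem_pure` — its elements are
  `eval (x, g₂, g₁) G` for a `G ∈ S[X₀, X₁, X₂]` supported on pure exponents (all of critical weight `j r₁ ν`);
* `pure_inf_critical_succ_le` — **`P ⊓ F₃(j r₁ ν + 1) ≤ 𝔪 · P`** (`S` regular local of dimension three, `𝔪 = (x, g₂, g₁)`): a combination of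
  pure monomials one critical step too deep has all its coefficients in `𝔪`; and `𝔪 · P ≤ F(r₁ν + 1)`;
* `shift_pow_mem_pure` — `(g₁ − t g₂^ρ)^ν ∈ P` when `r₁ = ρ r₂`;
* `pure_sub_not_mem_critical_succ` and **`critical_nonSolvable`** — under the ratio bound of the dominance word at an exactly ratio-maximal
  `(q; r₁, r₂)` with `q < r₂`, `r₁ = ρ r₂`, for the pure part `π` of `f` (`f = π + h` as in `Iota3.exists_pure_add`): `π − u (g₁ − t g₂^ρ)^ν ∉
  F₃(j r₁ ν + 1)` for ALL `u, t ∈ S` — in the critical graded ring, `in₃(f) = in₃(π) ∈ κ[V, Y]` is NOT `ū (Y − t̄ V^ρ)^ν`.  This is hypothesis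
  (NS) of LEMMA C in the memo RESIDUE-PLAN.md; what remains for hres₃ is LEMMA C itself (pure algebra) and the `inForm` reading of both flags.

[OURS · L1 W4.3 · (o70-b)/(Δ12); AI work, weaker than expert review; nothing here is a statement of the manuscript under review.]
-/

noncomputable section

open IsLocalRing Literature.AlgebraicGeometry.Resolution MvPolynomial
open Summit.ResolutionOfSingularities.ResolutionOfSingularities.Theorems

set_option linter.dupNamespace false -- mandated namespace of this single-conjunct summit

namespace Summit.ResolutionOfSingularities.ResolutionOfSingularities.Cruxes.HypersurfaceCentreConstruction.LocalEngine

namespace Iota3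

universe u

section Local

variable {S : Type u} [CommRing S] [IsLocalRing S]

omit [IsLocalRing S] in
/-- The pure ideal as a span. [folklore] -/
theorem pureIdeal_eq_span (g₁ g₂ : S) (r₁ r₂ ν : ℕ) :
    (⨆ α : ℕ, ⨆ β : ℕ, ⨆ (_ : r₁ * α + r₂ * β = r₁ * ν), Ideal.span {g₁ ^ α * g₂ ^ β}) =
      Ideal.span {m | ∃ α β : ℕ, r₁ * α + r₂ * β = r₁ * ν ∧ m = g₁ ^ α * g₂ ^ β} := by
  refine le_antisymm (iSup_le fun α => iSup_le fun β => iSup_le fun h => ?_) ?_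
  · rw [Ideal.span_singleton_le_iff_mem]
    exact Ideal.subset_span ⟨α, β, h, rfl⟩
  · rw [Ideal.span_le]
    rintro _ ⟨α, β, h, rfl⟩
    exact Submodule.mem_iSup_of_mem α (Submodule.mem_iSup_of_mem β
      (Submodule.mem_iSup_of_mem h (Ideal.mem_span_singleton_self _)))

/-- The pure ideal lies in level `r₁ν`. [folklore] -/
theorem pureIdeal_le (g₁ g₂ : S) {q : ℕ} (hq : 0 < q) (r₁ r₂ ν : ℕ) :
    (⨆ α : ℕ, ⨆ β : ℕ, ⨆ (_ : r₁ * α + r₂ * β = r₁ * ν), Ideal.span {g₁ ^ α * g₂ ^ β}) ≤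
      flagContactFiltration g₁ g₂ q r₁ r₂ (r₁ * ν) := by
  refine iSup_le fun α => iSup_le fun β => iSup_le fun h => ?_
  rw [Ideal.span_singleton_le_iff_mem]
  have hm := mul_mem_flagContactFiltration_of_weight (g₁ := g₁) (g₂ := g₂) (q := q) (r₁ := r₁) (r₂ := r₂) (n := r₁ * ν)
    (α := α) (β := β) (k := 0) (c := 1) hq (by simp) (by omega)
  rwa [mul_one] at hm

/-- `𝔪 · P ≤ F(r₁ν + 1)` (`0 < q`). [folklore] -/
theorem maximalIdeal_mul_pureIdeal_le (g₁ g₂ : S) {q : ℕ} (hq : 0 < q) (r₁ r₂ ν : ℕ) :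
    maximalIdeal S * (⨆ α : ℕ, ⨆ β : ℕ, ⨆ (_ : r₁ * α + r₂ * β = r₁ * ν), Ideal.span {g₁ ^ α * g₂ ^ β}) ≤
      flagContactFiltration g₁ g₂ q r₁ r₂ (r₁ * ν + 1) := by
  refine (Ideal.mul_mono (maximalIdeal_le_flagContactFiltration g₁ g₂ r₁ r₂ hq) (pureIdeal_le g₁ g₂ hq r₁ r₂ ν)).trans ?_
  refine (flagContactFiltration_mul_le g₁ g₂ q r₁ r₂ hq _ _).trans (flagContactFiltration_antitone g₁ g₂ q r₁ r₂ ?_)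
  omega

omit [IsLocalRing S] in
/-- **`(g₁ − t g₂^ρ)^ν ∈ P`** when `r₁ = ρ r₂`: every term `g₁^k g₂^{ρ(ν−k)}` of the binomial expansion is pure. [folklore] -/
theorem shift_pow_mem_pure (g₁ g₂ t : S) {r₁ r₂ ρ : ℕ} (hρ : r₁ = ρ * r₂) (ν : ℕ) :
    (g₁ - t * g₂ ^ ρ) ^ ν ∈ (⨆ α : ℕ, ⨆ β : ℕ, ⨆ (_ : r₁ * α + r₂ * β = r₁ * ν), Ideal.span {g₁ ^ α * g₂ ^ β}) := by
  rw [sub_eq_add_neg, add_pow]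
  refine Ideal.sum_mem _ fun k hk => ?_
  have hkν : k ≤ ν := Nat.lt_succ_iff.mp (Finset.mem_range.mp hk)
  have hpure : r₁ * k + r₂ * (ρ * (ν - k)) = r₁ * ν := by
    rw [hρ, ← mul_assoc, mul_comm r₂ ρ, ← Nat.mul_add]
    congr 1
    omega
  have hmem : g₁ ^ k * g₂ ^ (ρ * (ν - k)) ∈
      (⨆ α : ℕ, ⨆ β : ℕ, ⨆ (_ : r₁ * α + r₂ * β = r₁ * ν), Ideal.span {g₁ ^ α * g₂ ^ β}) :=
    Submodule.mem_iSup_of_mem k (Submodule.mem_iSup_of_mem (ρ * (ν - k))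
      (Submodule.mem_iSup_of_mem hpure (Ideal.mem_span_singleton_self _)))
  have heq : g₁ ^ k * (-(t * g₂ ^ ρ)) ^ (ν - k) * (ν.choose k : S) =
      g₁ ^ k * g₂ ^ (ρ * (ν - k)) * ((-t) ^ (ν - k) * (ν.choose k : S)) := by
    rw [neg_mul_eq_neg_mul, mul_pow, ← pow_mul]; ring
  rw [heq]
  exact Ideal.mul_mem_right _ _ hmem

/-- **Elements of the pure ideal are pure polynomials in the flag**: `π ∈ P` is `eval (x, g₂, g₁) G` for some `G ∈ S[X₀,X₁,X₂]` whose
monomials `e` all have `e₀ = 0` and `r₁ e₂ + r₂ e₁ = r₁ν`. [folklore] -/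
theorem exists_poly_of_mem_pure {x g₁ g₂ π : S} {r₁ r₂ ν : ℕ}
    (hπ : π ∈ (⨆ α : ℕ, ⨆ β : ℕ, ⨆ (_ : r₁ * α + r₂ * β = r₁ * ν), Ideal.span {g₁ ^ α * g₂ ^ β})) :
    ∃ G : MvPolynomial (Fin 3) S, (∀ e ∈ G.support, e 0 = 0 ∧ r₁ * e 2 + r₂ * e 1 = r₁ * ν) ∧
      MvPolynomial.eval ![x, g₂, g₁] G = π := by
  classical
  rw [pureIdeal_eq_span] at hπ
  refine Submodule.span_induction ?_ ?_ ?_ ?_ hπ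
  · rintro _ ⟨α, β, h, rfl⟩
    refine ⟨monomial (Finsupp.single 1 β + Finsupp.single 2 α) 1, fun e he => ?_, ?_⟩
    · rw [support_monomial, if_neg one_ne_zero, Finset.mem_singleton] at he
      subst he
      constructor
      · simp
      · simpa [Finsupp.single_apply] using h
    · rw [eval_monomial_eq_monom3, one_mul, monom3]
      simp [mul_comm]
  · exact ⟨0, by simp, by simp⟩
  · rintro a b - - ⟨G, hG, rfl⟩ ⟨H, hH, rfl⟩
    refine ⟨G + H, fun e he => ?_, by rw [map_add]⟩
    rcases Finset.mem_union.mp (support_add he) with h | h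
    · exact hG e h
    · exact hH e h
  · rintro d a - ⟨G, hG, rfl⟩
    exact ⟨d • G, fun e he => hG e (support_smul he), by rw [smul_eval, smul_eq_mul]⟩

end Local

section Regular

variable {S : Type} [CommRing S] [IsRegularLocalRing S]

/-- **WEIGHTED QUASI-REGULARITY FOR THE PURE PART.**  `S` regular local of dimension `3`, `𝔪 = (x, g₂, g₁)`, `1 ≤ j`, `0 < r₂ ≤ r₁`:
a pure polynomial `G` (monomials `e` with `e₀ = 0`, `r₁e₂ + r₂e₁ = r₁ν`, all of critical weight `j r₁ ν`) with
`G(x, g₂, g₁) ∈ F₃(j r₁ ν + 1)` has all its coefficients in `𝔪`. [cite: CossartJannsenSaito2020, Lemma 8.3 (1)] -/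
theorem pure_coeff_mem_maximalIdeal (hdim : ringKrullDim S = 3) {x g₁ g₂ : S} {r₁ r₂ j ν : ℕ}
    (h𝔪 : Ideal.span {x, g₂, g₁} = maximalIdeal S) (hj : 1 ≤ j) (hr₂ : 0 < r₂) (hr : r₂ ≤ r₁)
    {G : MvPolynomial (Fin 3) S} (hG : ∀ e ∈ G.support, e 0 = 0 ∧ r₁ * e 2 + r₂ * e 1 = r₁ * ν)
    (hmem : MvPolynomial.eval ![x, g₂, g₁] G ∈ flagContactFiltration g₁ g₂ r₂ (j * r₁) (j * r₂) (j * r₁ * ν + 1)) :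
    ∀ e, G.coeff e ∈ maximalIdeal S := by
  have hq₂ : r₂ ≤ j * r₂ := Nat.le_mul_of_pos_left r₂ hj
  have hq₁ : r₂ ≤ j * r₁ := hr.trans (Nat.le_mul_of_pos_left r₁ hj)
  have hbridge : ∀ n, flagContactFiltration g₁ g₂ r₂ (j * r₁) (j * r₂) n = weightedIdealW ![x, g₂, g₁] ![r₂, j * r₂, j * r₁] n :=
    fun n => by
    rw [flagContactFiltration_eq_weightedMonomialIdeal h𝔪 hr₂ hq₂ hq₁ n, CrossingPoint.weightedMonomialIdeal_eq_weightedIdealW]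
  have hgen : Ideal.span {(![x, g₂, g₁] : Fin 3 → S) 0, (![x, g₂, g₁] : Fin 3 → S) 1, (![x, g₂, g₁] : Fin 3 → S) 2} =
      maximalIdeal S := by
    simpa using h𝔪
  have hw : ∀ i, 0 < (![r₂, j * r₂, j * r₁] : Fin 3 → ℕ) i := by
    intro i
    fin_cases i
    · exact hr₂
    · exact lt_of_lt_of_le hr₂ hq₂
    · exact lt_of_lt_of_le hr₂ hq₁
  have hwt : ∀ e : Fin 3 →₀ ℕ, Finsupp.weight (![r₂, j * r₂, j * r₁] : Fin 3 → ℕ) e =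
      r₂ * e 0 + j * r₂ * e 1 + j * r₁ * e 2 := fun e => by
    rw [Finsupp.weight_apply, Finsupp.sum_fintype _ _ (by simp)]
    simp [smul_eq_mul, mul_comm, Fin.sum_univ_three]
  have hsupp : ∀ m ∈ G.support, Finsupp.weight (![r₂, j * r₂, j * r₁] : Fin 3 → ℕ) m = j * r₁ * ν := by
    intro m hm
    obtain ⟨h0, hwm⟩ := hG m hm
    rw [hwt, h0, mul_zero, zero_add]
    have : j * (r₁ * m 2 + r₂ * m 1) = j * (r₁ * ν) := by rw [hwm]
    linarith [this]
  rw [hbridge] at hmem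
  exact coeff_mem_maximalIdeal_of_weval_mem_general ![x, g₂, g₁] hgen hdim _ hw hsupp hmem

/-- **`P ⊓ F₃(j r₁ ν + 1) ≤ 𝔪 · P`**: a combination of pure monomials lying one critical step too deep has its coefficients in `𝔪`
(`S` regular local of dimension `3`, `𝔪 = (x, g₂, g₁)`, `1 ≤ j`, `0 < r₂ ≤ r₁`). [OURS · L1 W4.3 · (o70-b)] -/
theorem pure_inf_critical_succ_le (hdim : ringKrullDim S = 3) {x g₁ g₂ : S} {r₁ r₂ j ν : ℕ}
    (h𝔪 : Ideal.span {x, g₂, g₁} = maximalIdeal S) (hj : 1 ≤ j) (hr₂ : 0 < r₂) (hr : r₂ ≤ r₁) :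
    (⨆ α : ℕ, ⨆ β : ℕ, ⨆ (_ : r₁ * α + r₂ * β = r₁ * ν), Ideal.span {g₁ ^ α * g₂ ^ β}) ⊓
        flagContactFiltration g₁ g₂ r₂ (j * r₁) (j * r₂) (j * r₁ * ν + 1) ≤
      maximalIdeal S * (⨆ α : ℕ, ⨆ β : ℕ, ⨆ (_ : r₁ * α + r₂ * β = r₁ * ν), Ideal.span {g₁ ^ α * g₂ ^ β}) := by
  intro π hπ
  obtain ⟨hπP, hπ₃⟩ := Submodule.mem_inf.mp hπ
  obtain ⟨G, hG, hGπ⟩ := exists_poly_of_mem_pure (x := x) hπP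
  rw [← hGπ] at hπ₃
  have hcoeff := pure_coeff_mem_maximalIdeal hdim h𝔪 hj hr₂ hr hG hπ₃
  rw [← hGπ, G.as_sum, map_sum]
  refine Ideal.sum_mem _ fun e he => ?_
  rw [eval_monomial_eq_monom3]
  refine Ideal.mul_mem_mul (hcoeff e) ?_
  obtain ⟨h0, hwe⟩ := hG e he
  have hmon : monom3 ![x, g₂, g₁] e = g₁ ^ e 2 * g₂ ^ e 1 := by
    rw [monom3, h0, pow_zero, one_mul, mul_comm]; rfl
  rw [hmon]
  exact Submodule.mem_iSup_of_mem (e 2) (Submodule.mem_iSup_of_mem (e 1)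
    (Submodule.mem_iSup_of_mem (by rw [← hwe, add_comm]) (Ideal.mem_span_singleton_self _)))

/-- **The pure part minus any pure `ν`-th power is not critically deep.**  If `π ∈ P`, `z^ν ∈ P`, and
`π ∉ (z^ν) + 𝔪·F(r₁ν − q) + F(r₁ν + 1)` (LEMMA B transferred to the pure part), then `π − u z^ν ∉ F₃(j r₁ ν + 1)` for every `u`.
[OURS · L1 W4.3 · (o70-b)] -/
theorem pure_sub_not_mem_critical_succ (hdim : ringKrullDim S = 3) {x g₁ g₂ π z : S} {q r₁ r₂ j ν : ℕ}
    (h𝔪 : Ideal.span {x, g₂, g₁} = maximalIdeal S) (hq : 0 < q) (hj : 1 ≤ j) (hr₂ : 0 < r₂) (hr : r₂ ≤ r₁)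
    (hπP : π ∈ (⨆ α : ℕ, ⨆ β : ℕ, ⨆ (_ : r₁ * α + r₂ * β = r₁ * ν), Ideal.span {g₁ ^ α * g₂ ^ β}))
    (hz : z ^ ν ∈ (⨆ α : ℕ, ⨆ β : ℕ, ⨆ (_ : r₁ * α + r₂ * β = r₁ * ν), Ideal.span {g₁ ^ α * g₂ ^ β}))
    (hπ : π ∉ Ideal.span {z ^ ν} ⊔ maximalIdeal S * flagContactFiltration g₁ g₂ q r₁ r₂ (r₁ * ν - q) ⊔
      flagContactFiltration g₁ g₂ q r₁ r₂ (r₁ * ν + 1)) (u : S) :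
    π - u * z ^ ν ∉ flagContactFiltration g₁ g₂ r₂ (j * r₁) (j * r₂) (j * r₁ * ν + 1) := by
  intro hdeep
  have hδP : π - u * z ^ ν ∈ (⨆ α : ℕ, ⨆ β : ℕ, ⨆ (_ : r₁ * α + r₂ * β = r₁ * ν), Ideal.span {g₁ ^ α * g₂ ^ β}) :=
    Ideal.sub_mem _ hπP (Ideal.mul_mem_left _ u hz)
  have hδ : π - u * z ^ ν ∈ flagContactFiltration g₁ g₂ q r₁ r₂ (r₁ * ν + 1) :=
    maximalIdeal_mul_pureIdeal_le g₁ g₂ hq r₁ r₂ ν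
      (pure_inf_critical_succ_le hdim h𝔪 hj hr₂ hr (Submodule.mem_inf.mpr ⟨hδP, hdeep⟩))
  refine hπ ?_
  have : π = u * z ^ ν + (π - u * z ^ ν) := by ring
  rw [this]
  exact Ideal.add_mem _ (Ideal.mem_sup_left (Ideal.mem_sup_left (Ideal.mem_span_singleton'.mpr ⟨u, rfl⟩)))
    (Ideal.mem_sup_right hδ)

/-- **NON-SOLVABILITY IN THE CRITICAL GRADED RING.**  `S` regular local of dimension `3`, `𝔪 = (x, g₂, g₁)` with `(g₁, g₂)` a two-flag;
under the ratio bound `a/b` of the dominance word (`0 < b`, `1 ≤ ν`), at an admissible `(q; r₁, r₂)` with `r₁ b = a r₂`, `q < r₂`,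
`r₁ = ρ r₂`; `1 ≤ j`, `qj < r₂`; `f ∈ F(r₁ν)` with pure part `π` (`f = π + h`, `h ∈ 𝔪·F(r₁ν − q) + F(r₁ν+1)`).  Then for ALL `u, t ∈ S`:
`π − u·(g₁ − t g₂^ρ)^ν ∉ F₃(j r₁ ν + 1)` — the critical initial form `in₃(f) = in₃(π) ∈ κ[V, Y]` is not `ū (Y − t̄ V^ρ)^ν`.
(LEMMA B `not_mem_span_shift_pow_sup_of_ratio_bound` + `pure_sub_not_mem_critical_succ`.)  This is hypothesis (NS) of LEMMA C.
[OURS · L1 W4.3 · (o70-b)/(Δ12)] -/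
theorem critical_nonSolvable (hdim : ringKrullDim S = 3) {x g₁ g₂ f π h : S} {q r₁ r₂ ρ j ν a b : ℕ}
    (h𝔪 : Ideal.span {x, g₂, g₁} = maximalIdeal S) (hΦ : IsTwoFlag g₁ g₂) (hν : 1 ≤ ν) (hb : 0 < b)
    (hbound : ∀ q' r₁' r₂' : ℕ, AdmissibleTriple q' r₁' r₂' → FlagReaches f ν q' r₁' r₂' → r₁' * b ≤ a * r₂')
    (hadm : AdmissibleTriple q r₁ r₂) (hab : r₁ * b = a * r₂) (hq₂ : q < r₂) (hρ : r₁ = ρ * r₂) (hj : 1 ≤ j) (hqj : q * j < r₂)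
    (hsum : f = π + h) (hπP : π ∈ (⨆ α : ℕ, ⨆ β : ℕ, ⨆ (_ : r₁ * α + r₂ * β = r₁ * ν), Ideal.span {g₁ ^ α * g₂ ^ β}))
    (hh : h ∈ maximalIdeal S * flagContactFiltration g₁ g₂ q r₁ r₂ (r₁ * ν - q) ⊔ flagContactFiltration g₁ g₂ q r₁ r₂ (r₁ * ν + 1))
    (u t : S) :
    π - u * (g₁ - t * g₂ ^ ρ) ^ ν ∉ flagContactFiltration g₁ g₂ r₂ (j * r₁) (j * r₂) (j * r₁ * ν + 1) := by
  have hq : 0 < q := hadm.1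
  have hr : r₂ ≤ r₁ := hadm.2.2
  have hB := not_mem_span_shift_pow_sup_of_ratio_bound hν hb hbound hΦ hadm hab hq₂ hρ t
  exact pure_sub_not_mem_critical_succ hdim h𝔪 hq hj (by omega) hr hπP (shift_pow_mem_pure g₁ g₂ t hρ ν)
    (pure_not_mem_of_not_mem hsum hh hB) u

/-- The unshifted companion (any `r₁`, `r₂`; the case `r₂ ∤ r₁` of LEMMA C): `π − u·g₁^ν ∉ F₃(j r₁ ν + 1)` for all `u`.
[OURS · L1 W4.3 · (o70-b)/(Δ12)] -/
theorem critical_nonSolvable_pow (hdim : ringKrullDim S = 3) {x g₁ g₂ f π h : S} {q r₁ r₂ j ν a b : ℕ}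
    (h𝔪 : Ideal.span {x, g₂, g₁} = maximalIdeal S) (hΦ : IsTwoFlag g₁ g₂) (hν : 1 ≤ ν) (hb : 0 < b)
    (hbound : ∀ q' r₁' r₂' : ℕ, AdmissibleTriple q' r₁' r₂' → FlagReaches f ν q' r₁' r₂' → r₁' * b ≤ a * r₂')
    (hadm : AdmissibleTriple q r₁ r₂) (hab : r₁ * b = a * r₂) (hq₂ : q < r₂) (hj : 1 ≤ j) (hqj : q * j < r₂)
    (hsum : f = π + h) (hπP : π ∈ (⨆ α : ℕ, ⨆ β : ℕ, ⨆ (_ : r₁ * α + r₂ * β = r₁ * ν), Ideal.span {g₁ ^ α * g₂ ^ β}))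
    (hh : h ∈ maximalIdeal S * flagContactFiltration g₁ g₂ q r₁ r₂ (r₁ * ν - q) ⊔ flagContactFiltration g₁ g₂ q r₁ r₂ (r₁ * ν + 1))
    (u : S) :
    π - u * g₁ ^ ν ∉ flagContactFiltration g₁ g₂ r₂ (j * r₁) (j * r₂) (j * r₁ * ν + 1) := by
  have hq : 0 < q := hadm.1
  have hr : r₂ ≤ r₁ := hadm.2.2
  have hB := not_mem_span_pow_sup_of_ratio_bound hν hb hbound hΦ hadm hab hq₂
  have hz : g₁ ^ ν ∈ (⨆ α : ℕ, ⨆ β : ℕ, ⨆ (_ : r₁ * α + r₂ * β = r₁ * ν), Ideal.span {g₁ ^ α * g₂ ^ β}) :=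
    Submodule.mem_iSup_of_mem ν (Submodule.mem_iSup_of_mem 0
      (Submodule.mem_iSup_of_mem (by ring) (by rw [pow_zero, mul_one]; exact Ideal.mem_span_singleton_self _)))
  exact pure_sub_not_mem_critical_succ hdim h𝔪 hq hj (by omega) hr hπP hz (pure_not_mem_of_not_mem hsum hh hB) u

end Regular

end Iota3

end Summit.ResolutionOfSingularities.ResolutionOfSingularities.Cruxes.HypersurfaceCentreConstruction.LocalEngine

end
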